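import Summits.PneNP.PneNP.Theses.DescentTower
import Literature.Computability.Complexity.PRelHierarchy
import Literature.Computability.Complexity.BranchingFn

/-!
# Route DescentTower — `ThreeColKarpReducibleChromatic` (stmt-PneNP-2541)

`3-COL ≤ₚ CHROMATIC NUMBER` via `x ↦ ⟨x, ⌜3⌝⟩` (`pairFn id (const ⌜3⌝) ∈ FP`); correctness by unfolding the two
`toLanguage` images and injectivity of `boolPair` / `encodeNat` (invalid codes map to invalid codes).
-/

set_option linter.dupNamespace false -- `Summit.PneNP.PneNP.…`: summit = sub-problem name (D-0017 single-conjunct layout)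

namespace Summit.PneNP.PneNP.Theorems

open Literature.Computability.Complexity Computability

/-- **Support item `ThreeColKarpReducibleChromatic` of route DescentTower (stmt-PneNP-2541)**: the map `x ↦ ⟨x, ⌜3⌝⟩`
Karp-reduces the code language of 3-colourable graphs to `CHROMATIC`. [cite: Karp1972, §4 (problem 12)] [folklore] -/
theorem descentTower_threeColKarpReducibleChromatic_proof :
    Summit.PneNP.PneNP.Theses.DescentTower.ThreeColKarpReducibleChromatic := by
  unfold Summit.PneNP.PneNP.Theses.DescentTower.ThreeColKarpReducibleChromatic
  rw [polyTimeKarpReducible_iff]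
  refine ⟨pairFn (fun w => w) (fun _ => encodeNat 3),
    pairFn_mem_FP (PolyTimeComputable.id _) (const_mem_FP _), fun x => ?_⟩
  rw [pairFn_apply]
  constructor
  · rintro ⟨G, hG, rfl⟩
    exact ⟨(G, 3), hG, by simp [Computability.Encoding.pairBool, Computability.encodingNatBool]⟩
  · rintro ⟨⟨G, k⟩, hGk, hcode⟩
    have h := congrArg boolUnpair hcode
    simp only [Computability.Encoding.pairBool, Computability.encodingNatBool, boolUnpair_boolPair, Prod.mk.injEq] at h
    obtain ⟨hx, hk⟩ := h
    have hk3 : k = 3 := by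
      have := congrArg decodeNat hk
      simpa [Computability.decode_encodeNat] using this
    subst hk3
    exact ⟨G, hGk, hx⟩

end Summit.PneNP.PneNP.Theorems
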